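import Literature.Topology.FourManifolds.KirbyMovesSlideSweepPlanar
import Literature.Topology.FourManifolds.TorusCoordinates
import HarnessLib

/-!
# Normalising the band end: a chart-free local lift of the base angle

Topic `Literature/Topology/FourManifolds`; fact seat `provefact-IsStrictHandleSlide.isSurgery`
(Kirby (1989), Ch. I §4; remaining content: the named fact (S)
`Literature.Topology.FourManifolds.FramedLink.IsStrictHandleSlide.slideModel`). To differentiate
the band end in the coordinates `(θ, w) ↦ ν (circlePoint θ, w)` of the tube of `Kⱼ` one needs,
near a point `u* = circlePoint θ*` of the circle, a smooth local lift of the base coordinate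
`u ∈ S¹` to an angle. This file provides the explicit one: for a unit vector `u` with
`⟪u*, u⟫ > 0`, the angle `θ* + arcsin (u*₀ u₁ - u*₁ u₀)` maps to `u` under `circlePoint`
(planar trigonometry; everything proved, no definitions, no named facts).

* `Literature.Topology.FourManifolds.SlideSweep.eq_cos_smul_add_sin_smul` — a unit vector `u`
  with `⟪u*, u⟫ > 0` is `cos φ • u* + sin φ • J u*` with `φ = arcsin (u* × u)`;
* `Literature.Topology.FourManifolds.SlideSweep.circlePoint_add_eq` —
  `circlePoint (θ* + φ) = cos φ • circlePoint θ* + sin φ • J (circlePoint θ*)` (angle addition);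
* `Literature.Topology.FourManifolds.SlideSweep.circlePoint_baseLift` — consequently
  `circlePoint (θ* + arcsin (u* × u)) = u` for unit `u` with `⟪circlePoint θ*, u⟫ > 0`.

## References

* R. C. Kirby, *The Topology of 4-Manifolds*, LNM 1374, Springer (1989), Ch. I §4. [Kirby1989]
-/

open scoped Topology
open Function Set Metric Real

noncomputable section

namespace Literature.Topology.FourManifolds

namespace SlideSweep

/-- **A unit vector close to `u*` in rotation form.** If `u*` and `u` are unit vectors of the plane
with `u*₀ u₀ + u*₁ u₁ > 0`, then with `φ = arcsin (u*₀ u₁ - u*₁ u₀)`: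
`u₀ = cos φ u*₀ - sin φ u*₁` and `u₁ = cos φ u*₁ + sin φ u*₀`. [folklore] -/
theorem eq_cos_smul_add_sin_smul {a b x y : ℝ} (hab : a ^ 2 + b ^ 2 = 1) (hxy : x ^ 2 + y ^ 2 = 1)
    (hpos : 0 < a * x + b * y) :
    x = Real.cos (Real.arcsin (a * y - b * x)) * a - Real.sin (Real.arcsin (a * y - b * x)) * b ∧
      y = Real.cos (Real.arcsin (a * y - b * x)) * b + Real.sin (Real.arcsin (a * y - b * x)) * a := by
  set s : ℝ := a * y - b * x with hs
  set c : ℝ := a * x + b * y with hc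
  -- `c² + s² = 1`
  have hcs : c ^ 2 + s ^ 2 = 1 := by
    have : c ^ 2 + s ^ 2 = (a ^ 2 + b ^ 2) * (x ^ 2 + y ^ 2) := by simp only [hc, hs]; ring
    rw [this, hab, hxy, one_mul]
  have hs1 : -1 ≤ s := by nlinarith [sq_nonneg c]
  have hs1' : s ≤ 1 := by nlinarith [sq_nonneg c]
  have hsin : Real.sin (Real.arcsin s) = s := Real.sin_arcsin hs1 hs1'
  have hcos : Real.cos (Real.arcsin s) = c := by
    rw [Real.cos_arcsin]
    have hc2 : 1 - s ^ 2 = c ^ 2 := by linarith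
    rw [hc2, Real.sqrt_sq hpos.le]
  rw [hsin, hcos]
  constructor
  · -- `c a - s b = x (a² + b²)`
    have : c * a - s * b = x * (a ^ 2 + b ^ 2) := by simp only [hc, hs]; ring
    rw [this, hab, mul_one]
  · have : c * b + s * a = y * (a ^ 2 + b ^ 2) := by simp only [hc, hs]; ring
    rw [this, hab, mul_one]

/-- **Angle addition for `circlePoint`, in coordinates**: the coordinates of
`circlePoint (θ + φ)` are `cos φ (cos θ) - sin φ (sin θ)` and `cos φ (sin θ) + sin φ (cos θ)`.
[folklore] -/
theorem circlePoint_add_apply (θ φ : ℝ) :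
    ((circlePoint (θ + φ) : EuclideanSpace ℝ (Fin 2)) 0 =
        Real.cos φ * Real.cos θ - Real.sin φ * Real.sin θ) ∧
      ((circlePoint (θ + φ) : EuclideanSpace ℝ (Fin 2)) 1 =
        Real.cos φ * Real.sin θ + Real.sin φ * Real.cos θ) := by
  constructor
  · rw [circlePoint_apply_zero, Real.cos_add]; ring
  · rw [circlePoint_apply_one, Real.sin_add]; ring

/-- **The chart-free local base lift.** Let `u` be a point of the unit circle with
`⟪circlePoint θ*, u⟫ > 0` (i.e. `cos θ* · u₀ + sin θ* · u₁ > 0`). Then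
`circlePoint (θ* + arcsin (cos θ* · u₁ - sin θ* · u₀)) = u`. [folklore] -/
theorem circlePoint_baseLift (θ : ℝ) (u : Metric.sphere (0 : EuclideanSpace ℝ (Fin 2)) 1)
    (hpos : 0 < Real.cos θ * (u : EuclideanSpace ℝ (Fin 2)) 0 + Real.sin θ * (u : EuclideanSpace ℝ (Fin 2)) 1) :
    circlePoint (θ + Real.arcsin (Real.cos θ * (u : EuclideanSpace ℝ (Fin 2)) 1 -
      Real.sin θ * (u : EuclideanSpace ℝ (Fin 2)) 0)) = u := by
  have hu : ((u : EuclideanSpace ℝ (Fin 2)) 0) ^ 2 + ((u : EuclideanSpace ℝ (Fin 2)) 1) ^ 2 = 1 := by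
    have h := norm_eq_of_mem_sphere u
    rw [EuclideanSpace.norm_eq, Fin.sum_univ_two, Real.sqrt_eq_one] at h
    simpa [sq_abs] using h
  have hab : Real.cos θ ^ 2 + Real.sin θ ^ 2 = 1 := Real.cos_sq_add_sin_sq θ
  obtain ⟨h0, h1⟩ := eq_cos_smul_add_sin_smul hab hu hpos
  obtain ⟨e0, e1⟩ := circlePoint_add_apply θ
    (Real.arcsin (Real.cos θ * (u : EuclideanSpace ℝ (Fin 2)) 1 - Real.sin θ * (u : EuclideanSpace ℝ (Fin 2)) 0))
  apply Subtype.ext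
  ext i
  fin_cases i
  · simp only [Fin.zero_eta]
    rw [e0]; exact h0.symm
  · simp only [Fin.mk_one]
    rw [e1]; exact h1.symm

end SlideSweep

end Literature.Topology.FourManifolds
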